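import Literature.NumberTheory.PAdicHodge.BmaxPlusKerTheta
import Literature.NumberTheory.PAdicHodge.BdRPlusLatticeComplete
import HarnessLib

/-!
# Division with remainder by `ξ/p − d` in `A_max`: `A_max = 𝔸_inf + (ξ/p − d)·A_max`

Topic `Literature/NumberTheory/PAdicHodge`; namespace `Literature.NumberTheory.PAdicHodge`. THEOREMS ONLY (no definition, no named
fact, no instance). Continuation of `BmaxZero` / `BmaxPlus` / `BmaxPlusKerTheta` on Colmez's integral crystalline ring
`A_max = B_max⁺(F)` (`BmaxPlus`, the `p`-adic completion of `B⁰_max = 𝔸_inf[ξ/p]`, `T = ξ/p = omegaB`).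

* `exists_eq_ainf_add_sub_mul` — **for every `g ∈ A_max` and every `d ∈ 𝔸_inf` there are `a ∈ 𝔸_inf` and `G ∈ A_max` with
  `g = ι(a) + (ξ/p − ι(d))·G`** (`ι : 𝔸_inf → A_max`). Proof: choose polynomial representatives `Q_n ∈ 𝔸_inf[X]` of
  `g mod pⁿ` which are `p`-adically COMPATIBLE (`Q_{n+1} − Q_n ∈ pⁿ𝔸_inf[X]`, by lifting the successive differences), divide each by
  the monic linear polynomial `X − d` (`Q_n = Q_n(d) + (X − d)·S_n`), and pass to the `p`-adic limits `a = lim Q_n(d)` in `𝔸_inf`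
  (`𝕎(𝒪♭)` is `p`-adically complete, tree `GaloisContinuity.exists_padic_lim_ainf`) and `G = lim S_n(ξ/p)` in `A_max`.
* `exists_eq_ainf_add_omegaB_add_one_mul` — the case `d = −1`: **`g = ι(a) + (ξ/p + 1)·G`**, i.e. every element has a "constant term"
  with respect to `ω' = ξ/p + 1 = [p♭]/p` (the variable with the exact Frobenius `φ(ω') = p^{p−1}ω'^p`, `BmaxPlusFrobeniusImage`).

This is the division step of the `t`-divisibility theorem (TDIV) for `(A_max)^{φ=p} ∩ ker θ` (brick B7 of the φ-road of line
`kato_lever`, crux K★ `stmt-BirchSwinnertonDyer-22226`, memo `Cruxes/StarredOptimalManinUnitFiveSeven/Lines/kato-lever-K2-fontaine-lemma-g24.md`):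
with `d = p^{pᵐ−1} − 1` it yields the structure of `ker(θ∘φᵐ|A_max)`. Infrastructure only: BSD / K★ are not proved by any of this.

## References
* [Colmez1998Annals] P. Colmez, *Théorie d'Iwasawa des représentations de de Rham d'un corps local*, Ann. of Math. 148 (1998), §III.2
  (`A_max` as convergent series `Σ aₙ (ξ/p)ⁿ`).
* [BergerLaurent2002] L. Berger, *Représentations p-adiques et équations différentielles*, Invent. Math. 148 (2002), §1.2.
-/

noncomputable section

open WittVector Field ValuativeRel Polynomial Finset
open Literature.AlgebraicGeometry.Resolution

namespace Literature.NumberTheory.PAdicHodge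

open Literature.NumberTheory.GaloisRepresentations
open Literature.NumberTheory.GaloisRepresentations.IsNonarchimedeanLocalField

variable {F : Type} [Field F] [ValuativeRel F] [TopologicalSpace F] [IsNonarchimedeanLocalField F]
  {p : ℕ} [Fact p.Prime] [Fact (¬ IsUnit (p : integerC F))]

/-! ### Compatible polynomial representatives -/

set_option maxHeartbeats 800000 in
/-- **Compatible polynomial representatives**: every `g ∈ A_max` admits polynomials `Q_n ∈ 𝔸_inf[X]` with `g ≡ Q_n(ξ/p) (mod pⁿ)`
and `Q_{n+1} = Q_n + pⁿ·R_n` for polynomials `R_n` (lift the level representatives, then lift the successive differences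
`∈ pⁿB⁰_max = pⁿ·𝔸_inf[ξ/p]`). [cite: Colmez1998Annals, §III.2] -/
theorem exists_polynomial_representatives (g : BmaxPlus F p) :
    ∃ (Q R : ℕ → (Ainf (p := p) F)[X]),
      (∀ n, AdicCompletion.evalₐ (Ideal.span {(p : bmaxZero F p)}) n g =
        Ideal.Quotient.mk _ (aeval (omegaB : bmaxZero F p) (Q n))) ∧
      (∀ n, Q (n + 1) = Q n + C ((p : Ainf (p := p) F) ^ n) * R n) := by
  -- level representatives
  choose y hy using fun n => Ideal.Quotient.mk_surjective (AdicCompletion.evalₐ (Ideal.span {(p : bmaxZero F p)}) n g)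
  -- successive differences are divisible by `pⁿ`
  have hdiff : ∀ n, ∃ d : bmaxZero F p, y (n + 1) = y n + (p : bmaxZero F p) ^ n * d := by
    intro n
    have h := factorPow_evalₐ (Ideal.span {(p : bmaxZero F p)}) (Nat.le_succ n) g
    have e : Ideal.Quotient.mk (Ideal.span {(p : bmaxZero F p)} ^ n) (y (n + 1)) =
        Ideal.Quotient.mk (Ideal.span {(p : bmaxZero F p)} ^ n) (y n) :=
      calc Ideal.Quotient.mk (Ideal.span {(p : bmaxZero F p)} ^ n) (y (n + 1))
          = Ideal.Quotient.factorPow (Ideal.span {(p : bmaxZero F p)}) (Nat.le_succ n)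
              (Ideal.Quotient.mk (Ideal.span {(p : bmaxZero F p)} ^ (n + 1)) (y (n + 1))) := (Ideal.Quotient.factor_mk _ _).symm
        _ = Ideal.Quotient.factorPow (Ideal.span {(p : bmaxZero F p)}) (Nat.le_succ n)
              (AdicCompletion.evalₐ (Ideal.span {(p : bmaxZero F p)}) (n + 1) g) := congrArg _ (hy (n + 1))
        _ = AdicCompletion.evalₐ (Ideal.span {(p : bmaxZero F p)}) n g := h
        _ = Ideal.Quotient.mk (Ideal.span {(p : bmaxZero F p)} ^ n) (y n) := (hy n).symm
    have h2 : y (n + 1) - y n ∈ Ideal.span {(p : bmaxZero F p)} ^ n := (Ideal.Quotient.eq).1 e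
    rw [Ideal.span_singleton_pow, Ideal.mem_span_singleton'] at h2
    obtain ⟨d, hd⟩ := h2
    exact ⟨d, by rw [mul_comm, hd, add_sub_cancel]⟩
  choose d hd using hdiff
  obtain ⟨q₀, hq₀⟩ := exists_aeval_omegaB_eq (y 0)
  choose r hr using fun n => exists_aeval_omegaB_eq (d n)
  let Q : ℕ → (Ainf (p := p) F)[X] := fun n => Nat.rec q₀ (fun k acc => acc + C ((p : Ainf (p := p) F) ^ k) * r k) n
  have hQ0 : Q 0 = q₀ := rfl
  have hQs : ∀ n, Q (n + 1) = Q n + C ((p : Ainf (p := p) F) ^ n) * r n := fun n => rfl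
  have haeval : ∀ n, aeval (omegaB : bmaxZero F p) (Q n) = y n := by
    intro n
    induction n with
    | zero => rw [hQ0, hq₀]
    | succ n ih => rw [hQs, map_add, map_mul, aeval_C, map_pow, map_natCast, ih, hr, hd]
  exact ⟨Q, r, fun n => by rw [haeval]; exact (hy n).symm, hQs⟩

/-! ### Division with remainder by `ξ/p − d` -/

/-- Polynomial division by `X − d`: `Q = Q(d) + (X − d)·(Q /ₘ (X − d))`. [folklore] -/
private theorem eq_C_eval_add_X_sub_C_mul (Q : (Ainf (p := p) F)[X]) (d : Ainf (p := p) F) :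
    Q = C (Q.eval d) + (X - C d) * (Q /ₘ (X - C d)) := by
  have h := modByMonic_add_div Q (X - C d)
  rw [modByMonic_X_sub_C_eq_C_eval] at h
  exact h.symm

/-- The telescoping quotients `S_n = S_0 + Σ_{i<n} pⁱ·(R_i /ₘ (X − d))`, evaluated at `ξ/p`, differ by multiples of `p^m`:
`S_n(ξ/p) − S_m(ξ/p) ∈ p^m B⁰_max` for `m ≤ n`. [folklore] -/
private theorem aeval_sub_aeval_mem_pow (S₀ : (Ainf (p := p) F)[X]) (R : ℕ → (Ainf (p := p) F)[X]) {m n : ℕ} (hmn : m ≤ n) :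
    aeval (omegaB : bmaxZero F p) (S₀ + ∑ i ∈ range n, C ((p : Ainf (p := p) F) ^ i) * R i) -
        aeval (omegaB : bmaxZero F p) (S₀ + ∑ i ∈ range m, C ((p : Ainf (p := p) F) ^ i) * R i) ∈
      Ideal.span {(p : bmaxZero F p)} ^ m := by
  rw [map_add, map_add, add_sub_add_left_eq_sub, map_sum, map_sum, ← sum_Ico_eq_sub _ hmn]
  refine Ideal.sum_mem _ fun i hi => ?_
  have hmi : m ≤ i := (mem_Ico.1 hi).1
  rw [map_mul, aeval_C, map_pow, map_natCast, Ideal.span_singleton_pow]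
  exact Ideal.mul_mem_right _ _ (Ideal.span_singleton_le_span_singleton.2 (pow_dvd_pow _ hmi) (Ideal.mem_span_singleton_self _))

set_option maxHeartbeats 1600000 in
set_option synthInstance.maxHeartbeats 400000 in
/-- ★ **Division with remainder by `ξ/p − d` in `A_max`**: for every `g ∈ A_max = B_max⁺(F)` and every `d ∈ 𝔸_inf` there are
`a ∈ 𝔸_inf` and `G ∈ A_max` with `g = ι(a) + (ξ/p − ι(d))·G` — i.e. `A_max = ι(𝔸_inf) + (ξ/p − d)·A_max` (expand `g` as a
`p`-adically convergent series in `ξ/p` with coefficients in `𝔸_inf` and re-centre at `d`). [cite: Colmez1998Annals, §III.2] -/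
theorem exists_eq_ainf_add_sub_mul (g : BmaxPlus F p) (d : Ainf (p := p) F) :
    ∃ (a : Ainf (p := p) F) (G : BmaxPlus F p),
      g = ainfToBmaxPlus F p a +
        (algebraMap (bmaxZero F p) (BmaxPlus F p) omegaB - ainfToBmaxPlus F p d) * G := by
  obtain ⟨Q, R, hQ, hQR⟩ := exists_polynomial_representatives g
  -- constant terms and quotients, written as telescoping sums so that compatibility is automatic
  obtain ⟨a, ha0, ha_succ⟩ : ∃ a : ℕ → Ainf (p := p) F, a 0 = (Q 0).eval d ∧
      ∀ n, a (n + 1) = a n + (p : Ainf (p := p) F) ^ n * (R n).eval d :=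
    ⟨fun n => (Q 0).eval d + ∑ i ∈ range n, (p : Ainf (p := p) F) ^ i * (R i).eval d,
      by simp only [sum_range_zero, add_zero], fun n => by simp only [sum_range_succ, add_assoc]⟩
  obtain ⟨S, hS0, hS_succ⟩ : ∃ S : ℕ → (Ainf (p := p) F)[X], S 0 = (Q 0) /ₘ (X - C d) ∧
      ∀ n, S (n + 1) = S n + C ((p : Ainf (p := p) F) ^ n) * ((R n) /ₘ (X - C d)) :=
    ⟨fun n => (Q 0) /ₘ (X - C d) + ∑ i ∈ range n, C ((p : Ainf (p := p) F) ^ i) * ((R i) /ₘ (X - C d)),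
      by simp only [sum_range_zero, add_zero], fun n => by simp only [sum_range_succ, add_assoc]⟩
  have hQaS : ∀ n, Q n = C (a n) + (X - C d) * S n := by
    intro n
    induction n with
    | zero => rw [ha0, hS0]; exact eq_C_eval_add_X_sub_C_mul (Q 0) d
    | succ n ih =>
      rw [hQR n, ih, ha_succ, hS_succ, map_add, map_mul]
      have e := eq_C_eval_add_X_sub_C_mul (R n) d
      linear_combination (C ((p : Ainf (p := p) F) ^ n)) * e
  -- the constant terms converge `p`-adically in `𝔸_inf`
  have ha_cauchy : ∀ N, a (N + 1) - a N ∈ Ideal.span {((p : Ainf (p := p) F)) ^ N} := by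
    intro N
    rw [ha_succ, add_sub_cancel_left, Ideal.mem_span_singleton]
    exact ⟨(R N).eval d, rfl⟩
  obtain ⟨L, hL⟩ := GaloisContinuity.exists_padic_lim_ainf ha_cauchy
  -- the quotients converge `p`-adically in `A_max`
  have hS_tel : ∀ {m n : ℕ}, m ≤ n → aeval (omegaB : bmaxZero F p) (S n) - aeval (omegaB : bmaxZero F p) (S m) ∈
      Ideal.span {(p : bmaxZero F p)} ^ m := by
    intro m n hmn
    induction n, hmn using Nat.le_induction with
    | base => rw [sub_self]; exact Submodule.zero_mem _
    | succ n hmn ih =>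
      have e : aeval (omegaB : bmaxZero F p) (S (n + 1)) - aeval (omegaB : bmaxZero F p) (S m) =
          (p : bmaxZero F p) ^ n * aeval (omegaB : bmaxZero F p) ((R n) /ₘ (X - C d)) +
            (aeval (omegaB : bmaxZero F p) (S n) - aeval (omegaB : bmaxZero F p) (S m)) := by
        rw [hS_succ, map_add, map_mul, aeval_C, map_pow, map_natCast]; ring
      rw [e]
      refine add_mem ?_ ih
      rw [Ideal.span_singleton_pow]
      exact Ideal.mul_mem_right _ _
        (Ideal.span_singleton_le_span_singleton.2 (pow_dvd_pow _ hmn) (Ideal.mem_span_singleton_self _))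
  have hS_cauchy : AdicCompletion.IsAdicCauchy (Ideal.span {(p : bmaxZero F p)}) (bmaxZero F p)
      fun n => aeval (omegaB : bmaxZero F p) (S n) := by
    intro m n hmn
    rw [SModEq.sub_mem, smul_eq_mul, Ideal.mul_top, ← Ideal.neg_mem_iff, neg_sub]
    exact hS_tel hmn
  obtain ⟨G, hG⟩ : ∃ G : BmaxPlus F p, ∀ n, AdicCompletion.evalₐ (Ideal.span {(p : bmaxZero F p)}) n G =
      Ideal.Quotient.mk _ (aeval (omegaB : bmaxZero F p) (S n)) :=
    ⟨AdicCompletion.mk (Ideal.span {(p : bmaxZero F p)}) (bmaxZero F p) ⟨fun n => aeval (omegaB : bmaxZero F p) (S n), hS_cauchy⟩,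
      fun n => AdicCompletion.evalₐ_mk _ _ _⟩
  refine ⟨L, G, AdicCompletion.ext_evalₐ fun n => ?_⟩
  -- compare at level `n`
  have e2 : AdicCompletion.evalₐ (Ideal.span {(p : bmaxZero F p)}) n (algebraMap (bmaxZero F p) (BmaxPlus F p) omegaB) =
      Ideal.Quotient.mk _ omegaB := AdicCompletion.evalₐ_of _ n _
  have e3 : AdicCompletion.evalₐ (Ideal.span {(p : bmaxZero F p)}) n
      (ainfToBmaxPlus F p L + (algebraMap (bmaxZero F p) (BmaxPlus F p) omegaB - ainfToBmaxPlus F p d) * G) =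
      Ideal.Quotient.mk _ (algebraMap (Ainf (p := p) F) (bmaxZero F p) L +
        (omegaB - algebraMap (Ainf (p := p) F) (bmaxZero F p) d) * aeval (omegaB : bmaxZero F p) (S n)) := by
    simp only [map_add, map_mul, map_sub, evalₐ_ainfToBmaxPlus, hG n, e2]
  rw [e3, hQ n, Ideal.Quotient.eq, hQaS n]
  have e4 : aeval (omegaB : bmaxZero F p) (C (a n) + (X - C d) * S n) -
      (algebraMap (Ainf (p := p) F) (bmaxZero F p) L +
        (omegaB - algebraMap (Ainf (p := p) F) (bmaxZero F p) d) * aeval (omegaB : bmaxZero F p) (S n)) =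
      - algebraMap (Ainf (p := p) F) (bmaxZero F p) (L - a n) := by
    simp only [map_add, map_mul, map_sub, aeval_C, aeval_X]
    ring
  rw [e4, Ideal.neg_mem_iff]
  have h4 := hL n
  rw [Ideal.mem_span_singleton] at h4
  obtain ⟨c, hc⟩ := h4
  rw [hc, map_mul, map_pow, map_natCast, Ideal.span_singleton_pow]
  exact Ideal.mul_mem_right _ _ (Ideal.mem_span_singleton_self _)

set_option maxHeartbeats 800000 in
/-- **Constant term with respect to `ω' = ξ/p + 1`**: every `g ∈ A_max` is `ι(a) + (ξ/p + 1)·G` with `a ∈ 𝔸_inf`, `G ∈ A_max`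
(the case `d = −1`). [cite: Colmez1998Annals, §III.2] -/
theorem exists_eq_ainf_add_omegaB_add_one_mul (g : BmaxPlus F p) :
    ∃ (a : Ainf (p := p) F) (G : BmaxPlus F p),
      g = ainfToBmaxPlus F p a + (algebraMap (bmaxZero F p) (BmaxPlus F p) omegaB + 1) * G := by
  obtain ⟨a, G, h⟩ := exists_eq_ainf_add_sub_mul g (-1)
  have e : ainfToBmaxPlus F p (-1 : Ainf (p := p) F) = -1 := by rw [map_neg, map_one]
  refine ⟨a, G, ?_⟩
  rw [h, e, sub_neg_eq_add]

end Literature.NumberTheory.PAdicHodge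

end
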